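import Summits.NavierStokesRegularity.NavierStokesRegularity.Theses.SubcubicESS

/-!
# Birth skeleton — `QuinticNormDiscount` (X₁ of the split of `SubcubicBound`, item
stmt-NavierStokesRegularity-18289, route SubcubicESS; concludes the route decl BY NAME)

Line `mean-square-amplitude`: the half-slab `L⁵` norm is the `L³` level cubed times the
TIME-AVERAGED SQUARED AMPLITUDE (`∫|u|⁵ ≤ ‖u‖_∞² ∫|u|³` slice by slice), so X₁ follows from a
strictly sub-sextic bound on `∫_{t/2}^t ‖u(s)‖_∞² ds` — the mean-square shadow of a sub-cubic
amplitude bound, which (unlike the pointwise `o(A³)` of X) leaves room below the energy price.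

* `stub_meanSquareAmplitude` (OPEN, the heart): `∫_{t/2}^t m(s)² ds ≤ C A^θ` for some `θ < 6` and
  some pointwise majorant `m(s) ≥ ‖u(s)‖_∞` on the half-slab.
* `stub_quinticInterpolation` (provable support, Hölder in `lintegral` form):
  `∫_{t/2}^t∫|u|⁵ ≤ A³ ∫_{t/2}^t m(s)² ds`.
* `quinticNormDiscount_of_hyps` / `QuinticNormDiscount_of`: `a := (θ + 3)/5 < 9/5`, `C A^θ · A³ = C A^{5a}`.
-/

namespace Summit.NavierStokesRegularity.NavierStokesRegularity.Cruxes.QuinticNormDiscount.Lines.MeanSquareAmplitude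

open MeasureTheory Set
open scoped ENNReal NNReal

/-- STUB (open heart): strictly sub-sextic time-averaged squared amplitude on the last half-slab. -/
theorem stub_meanSquareAmplitude :
    ∃ C θ : ℝ, θ < 6 ∧ ∀ (T A : ℝ) (u : ℝ → EuclideanSpace ℝ (Fin 3) → EuclideanSpace ℝ (Fin 3))
      (p : ℝ → EuclideanSpace ℝ (Fin 3) → ℝ),
      (Literature.Analysis.FluidPDE.IsClassicalNSSolutionOn (Set.Icc 0 T) 1 0 u p ∧
        ∀ n : ℕ, ∃ C : NNReal, ∀ t ∈ Set.Icc 0 T,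
          MeasureTheory.eLpNorm (iteratedFDeriv ℝ n (u t)) 2 MeasureTheory.volume ≤ C) →
      (∀ t ∈ Set.Icc 0 T, MeasureTheory.eLpNorm (u t) 3 MeasureTheory.volume ≤ ENNReal.ofReal A) →
      2 ≤ A → ∀ t ∈ Set.Ioc 0 T, ∃ m : ℝ → ℝ, (∀ s ∈ Set.Icc (t / 2) t, 0 ≤ m s) ∧
        (∀ s ∈ Set.Icc (t / 2) t, ∀ x, ‖u s x‖ ≤ m s) ∧
        ∫⁻ s in Set.Icc (t / 2) t, ENNReal.ofReal (m s ^ 2) ≤ ENNReal.ofReal (C * A ^ θ) := by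
  sorry

/-- STUB (provable support): quintic interpolation `∫∫|u|⁵ ≤ A³ ∫ m²` in `lintegral` form. -/
theorem stub_quinticInterpolation :
    ∀ (t A : ℝ) (u : ℝ → EuclideanSpace ℝ (Fin 3) → EuclideanSpace ℝ (Fin 3)) (m : ℝ → ℝ),
      0 ≤ A → (∀ s ∈ Set.Icc (t / 2) t, 0 ≤ m s) →
      (∀ s ∈ Set.Icc (t / 2) t, ∀ x, ‖u s x‖ ≤ m s) →
      (∀ s ∈ Set.Icc (t / 2) t, MeasureTheory.eLpNorm (u s) 3 MeasureTheory.volume ≤ ENNReal.ofReal A) →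
      ∫⁻ s in Set.Icc (t / 2) t, ∫⁻ x : EuclideanSpace ℝ (Fin 3), ‖u s x‖ₑ ^ (5 : ℕ)
        ≤ ENNReal.ofReal (A ^ 3) * ∫⁻ s in Set.Icc (t / 2) t, ENNReal.ofReal (m s ^ 2) := by
  sorry

/-- COMPOSITION, parametric form (kernel-checked): the two stub STATEMENTS give the piece's statement
(unfolded) with `a = (θ+3)/5`. -/
theorem quinticNormDiscount_of_hyps
    (h₁ : ∃ C θ : ℝ, θ < 6 ∧ ∀ (T A : ℝ) (u : ℝ → EuclideanSpace ℝ (Fin 3) → EuclideanSpace ℝ (Fin 3))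
      (p : ℝ → EuclideanSpace ℝ (Fin 3) → ℝ),
      (Literature.Analysis.FluidPDE.IsClassicalNSSolutionOn (Set.Icc 0 T) 1 0 u p ∧
        ∀ n : ℕ, ∃ C : NNReal, ∀ t ∈ Set.Icc 0 T,
          MeasureTheory.eLpNorm (iteratedFDeriv ℝ n (u t)) 2 MeasureTheory.volume ≤ C) →
      (∀ t ∈ Set.Icc 0 T, MeasureTheory.eLpNorm (u t) 3 MeasureTheory.volume ≤ ENNReal.ofReal A) →
      2 ≤ A → ∀ t ∈ Set.Ioc 0 T, ∃ m : ℝ → ℝ, (∀ s ∈ Set.Icc (t / 2) t, 0 ≤ m s) ∧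
        (∀ s ∈ Set.Icc (t / 2) t, ∀ x, ‖u s x‖ ≤ m s) ∧
        ∫⁻ s in Set.Icc (t / 2) t, ENNReal.ofReal (m s ^ 2) ≤ ENNReal.ofReal (C * A ^ θ))
    (h₂ : ∀ (t A : ℝ) (u : ℝ → EuclideanSpace ℝ (Fin 3) → EuclideanSpace ℝ (Fin 3)) (m : ℝ → ℝ),
      0 ≤ A → (∀ s ∈ Set.Icc (t / 2) t, 0 ≤ m s) →
      (∀ s ∈ Set.Icc (t / 2) t, ∀ x, ‖u s x‖ ≤ m s) →
      (∀ s ∈ Set.Icc (t / 2) t, MeasureTheory.eLpNorm (u s) 3 MeasureTheory.volume ≤ ENNReal.ofReal A) →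
      ∫⁻ s in Set.Icc (t / 2) t, ∫⁻ x : EuclideanSpace ℝ (Fin 3), ‖u s x‖ₑ ^ (5 : ℕ)
        ≤ ENNReal.ofReal (A ^ 3) * ∫⁻ s in Set.Icc (t / 2) t, ENNReal.ofReal (m s ^ 2)) :
    ∃ C a : ℝ, a < 9 / 5 ∧ ∀ (T A : ℝ) (u : ℝ → EuclideanSpace ℝ (Fin 3) → EuclideanSpace ℝ (Fin 3)) (p : ℝ → EuclideanSpace ℝ (Fin 3) → ℝ), (Literature.Analysis.FluidPDE.IsClassicalNSSolutionOn (Set.Icc 0 T) 1 0 u p ∧ ∀ n : ℕ, ∃ C : NNReal, ∀ t ∈ Set.Icc 0 T, MeasureTheory.eLpNorm (iteratedFDeriv ℝ n (u t)) 2 MeasureTheory.volume ≤ C) → (∀ t ∈ Set.Icc 0 T, MeasureTheory.eLpNorm (u t) 3 MeasureTheory.volume ≤ ENNReal.ofReal A) → 2 ≤ A → ∀ t ∈ Set.Ioc 0 T, ∫⁻ s in Set.Icc (t / 2) t, ∫⁻ x : EuclideanSpace ℝ (Fin 3), ‖u s x‖ₑ ^ (5 : ℕ) ≤ ENNReal.ofReal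 (C * A ^ (5 * a)) := by
  obtain ⟨C, θ, hθ, h₁⟩ := h₁
  refine ⟨max C 0, (θ + 3) / 5, by linarith, ?_⟩
  intro T A u p hcl hL3 hA t ht
  have hA0 : 0 < A := by linarith
  have hA1 : 1 ≤ A := by linarith
  obtain ⟨m, hm0, hbd, hint⟩ := h₁ T A u p hcl hL3 hA t ht
  have hL3' : ∀ s ∈ Set.Icc (t / 2) t, eLpNorm (u s) 3 volume ≤ ENNReal.ofReal A := fun s hs =>
    hL3 s ⟨((half_pos ht.1).trans_le hs.1).le, hs.2.trans ht.2⟩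
  have hCA : C * A ^ θ ≤ max C 0 * A ^ θ :=
    mul_le_mul_of_nonneg_right (le_max_left _ _) (Real.rpow_nonneg hA0.le _)
  calc ∫⁻ s in Set.Icc (t / 2) t, ∫⁻ x : EuclideanSpace ℝ (Fin 3), ‖u s x‖ₑ ^ (5 : ℕ)
      ≤ ENNReal.ofReal (A ^ 3) * ∫⁻ s in Set.Icc (t / 2) t, ENNReal.ofReal (m s ^ 2) :=
        h₂ t A u m hA0.le hm0 hbd hL3'
    _ ≤ ENNReal.ofReal (A ^ 3) * ENNReal.ofReal (max C 0 * A ^ θ) := by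
        gcongr
        exact hint.trans (ENNReal.ofReal_le_ofReal hCA)
    _ = ENNReal.ofReal (max C 0 * A ^ (5 * ((θ + 3) / 5))) := by
        rw [← ENNReal.ofReal_mul (by positivity)]
        congr 1
        have h3 : A ^ (3 : ℕ) = A ^ (3 : ℝ) := by rw [← Real.rpow_natCast]; norm_num
        rw [h3, show 5 * ((θ + 3) / 5) = θ + 3 by ring, Real.rpow_add hA0]
        ring

/-- COMPOSITION (the skeleton's closing theorem): the registered stubs, by name, give the route decl
`Theses.SubcubicESS.QuinticNormDiscount` (which unfolds to the statement concluded by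
`quinticNormDiscount_of_hyps`). Sorries only inside the two stubs. -/
theorem QuinticNormDiscount_of :
    Summit.NavierStokesRegularity.NavierStokesRegularity.Theses.SubcubicESS.QuinticNormDiscount :=
  quinticNormDiscount_of_hyps stub_meanSquareAmplitude stub_quinticInterpolation

end Summit.NavierStokesRegularity.NavierStokesRegularity.Cruxes.QuinticNormDiscount.Lines.MeanSquareAmplitude
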